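import Mathlib
import Summits.KontsevichZagierPeriods.Zeta5Search.WedgeDictionaryVanishing
import HarnessLib

/-!
# Brown–Zudilin's leading coefficient `Q(a)` vanishes identically off the wide region (cell `pub-zeta5`, ct-1 g24)

HONEST FRAMING: systematic search; no irrationality claim unless certified.  Identities about the INTEGER `Q(a)` of
[BrownZudilin2022, (17)] (`BrownZudilin2022.QOf`, the finite double binomial sum) only; no integral is evaluated, nothing
about sizes, denominators or ζ(5); records in print UNMOVED.

OUR work (Summit side; seat `pub-zeta5-ct-1` generation 24, 2026-08-26).  Write `b = b(a) = (N; b₁,…,b₇)` for the dual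
coordinates (`bOfA`) and `d = d(b) = 3N − Σ_j b_j` (`dOf`).  The cell's WIDE region is the part of Brown–Zudilin's
convergence cone with `b_j ≥ 0` (`j = 1,…,7`) and `d ≥ 0`; on it ct-1 g23 proved the planners' Conjecture 2
(`WedgeDictionaryWideInduction.wedgeDictionaryFull_holds`) and hence the decomposition (4) with (17)
(`WedgeDictionaryWideConsequences.decomposition_on_wide_region`).  This file records the elementary fact that OFF the
wide region there is nothing for (17) to say:

* `QOf_eq_zero_of_slot_neg` — if some slot `b_i < 0` (`i ∈ [1,7]`) then `Q(a) = 0`;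
* `QOf_eq_zero_of_dOf_neg` — if `d(b(a)) < 0` then `Q(a) = 0`;
* `QOf_eq_zero_off_wide` — hence `Q(a) = 0` unless `b(a) ≥ 0` and `d(b(a)) ≥ 0`.

No convergence hypothesis is needed.  In each case one and the same binomial factor of EVERY term of the double sum (17)
vanishes, or the summation range is empty; in the twelve parameters `(p;q) = (p(a);q(a))` of (11) (`pOf`, `qOf`, index
conventions of `GeneralFamily`: `p = (p₀,…,p₆)`, entry `j` of `q` is `q_{j+1}`) the seven slots and `d` are
  `b₁ = p₅ + q₅ − p₆`, `b₂ = q₅`, `b₃ = q₁`, `b₄ = p₁ + q₁ − p₀`, `b₅ = p₁ + q₁ − p₂`, `b₆ = p₃ + q₃ − p₀ − p₆`,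
  `b₇ = p₅ + q₅ − p₄`, and `d = p₂ + q₂ + p₄ + q₄ − p₃`,
while a non-zero term of (17) needs `max(p₀,p₁,p₂) ≤ k₁ ≤ min(p₁+q₁, p₂+q₂)`, `max(p₄,p₅,p₆) ≤ k₂ ≤ min(p₄+q₄, p₅+q₅)`,
`k₁ + k₂ ≥ p₃` and `p₃ + q₃ − p₀ − p₆ ≥ 0`.  Together with gen-1 g4's `QOf_eq_zero_of_nonEpair` (the six non-edge pair
forms, `WedgeDictionaryVanishing`) this says: on the convergence cone, `Q(a) ≠ 0` forces `a` into the wide region with all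
six non-edge pair sums `≤ N`.  Consequently, off the wide region Brown–Zudilin's decomposition (4) is the statement
`I(a) ∈ ℚ + ℚ·ζ(2)` — the use the cell makes of this file (ct-1 g24, towards (4) on the whole cone).
Exact census before formalisation (seat folder `code/census.py`): all 148 687 convergent points of the box `{0,…,5}⁸`
off the wide region have `Q = 0`.
-/

open Finset

namespace Summit.KontsevichZagierPeriods.Zeta5Search.WedgeDictionary

open Literature.NumberTheory.Irrationality.BrownZudilin2022 (bOfA QOf Qcoeff pOf qOf zchoose)

/-- **`Q(a) = 0` as soon as one dual slot is negative** (`b_i(a) < 0` for some `i ∈ [1,7]`; no convergence hypothesis).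
Slot by slot, the vanishing binomial factor of every term of (17): `b₁ < 0`: `C(k₂,p₆)` or `C(q₅,k₂−p₅)`
(`p₆ > p₅+q₅`); `b₂ = q₅ < 0`: `C(q₅,k₂−p₅)`; `b₃ = q₁ < 0`: the `k₁`-range `[p₁, p₁+q₁]` is empty; `b₄ < 0`:
`C(k₁,p₀)` (`p₀ > p₁+q₁ ≥ k₁`); `b₅ < 0`: `C(q₂,k₁−p₂)` (`p₂ > p₁+q₁ ≥ k₁`); `b₆ < 0`: the middle factor
`C(k₁+k₂+q₃−p₀−p₆, p₃+q₃−p₀−p₆)` (negative lower index); `b₇ < 0`: `C(q₅,k₂−p₅)` (`k₂ ≥ p₄ > p₅+q₅`). -/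
theorem QOf_eq_zero_of_slot_neg (a : Fin 8 → ℤ) {i : ℕ} (hi : i ∈ Icc 1 7) (hneg : bOfA a i < 0) : QOf a = 0 := by
  have e3 : pOf a 3 = a 1 + a 2 + a 5 - a 7 := rfl
  have eq2 : qOf a 2 = a 0 + a 4 - a 2 := rfl
  have eq4 : qOf a 4 = a 1 := rfl
  rw [mem_Icc] at hi
  obtain ⟨hi1, hi7⟩ := hi
  unfold QOf Qcoeff
  refine mul_eq_zero_of_right _ (sum_eq_zero fun k₁ hk₁ => sum_eq_zero fun k₂ hk₂ => ?_)
  rw [mem_Icc, pOf_apply_1, qOf_apply_0] at hk₁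
  rw [mem_Icc, pOf_apply_4, qOf_apply_3] at hk₂
  interval_cases i
  · -- slot 1: `b₁ = −a₁ + a₃ + a₄`
    simp only [bOfA] at hneg
    by_cases hk : k₂ < pOf a 6
    · rw [zchoose_eq_zero (n := k₂) (k := pOf a 6) (Or.inr hk)]; ring
    · rw [pOf_apply_6] at hk
      rw [zchoose_eq_zero (n := qOf a 4) (k := k₂ - pOf a 5) (by rw [pOf_apply_5, eq4]; omega)]; ring
  · -- slot 2: `b₂ = a₂ = q₅`
    simp only [bOfA] at hneg
    rw [zchoose_eq_zero (n := qOf a 4) (k := k₂ - pOf a 5) (by rw [pOf_apply_5, eq4]; omega)]; ring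
  · -- slot 3: `b₃ = a₄ = q₁`, the `k₁`-range is empty
    simp only [bOfA] at hneg
    omega
  · -- slot 4: `b₄ = a₂ + a₃ − a₅`
    simp only [bOfA] at hneg
    rw [zchoose_eq_zero (n := k₁) (k := pOf a 0) (by rw [pOf_apply_0]; omega)]; ring
  · -- slot 5: `b₅ = a₂ + a₃ − a₈`
    simp only [bOfA] at hneg
    rw [zchoose_eq_zero (n := qOf a 1) (k := k₁ - pOf a 2) (by rw [pOf_apply_2, qOf_apply_1]; omega)]; ring
  · -- slot 6: `b₆ = a₄ − a₆ + a₈`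
    simp only [bOfA] at hneg
    rw [zchoose_eq_zero (n := k₁ + k₂ + qOf a 2 - pOf a 0 - pOf a 6) (k := pOf a 3 + qOf a 2 - pOf a 0 - pOf a 6)
      (by rw [pOf_apply_0, pOf_apply_6, e3, eq2]; omega)]
    ring
  · -- slot 7: `b₇ = a₂ + a₃ + a₆ − a₇ − a₈`
    simp only [bOfA] at hneg
    rw [zchoose_eq_zero (n := qOf a 4) (k := k₂ - pOf a 5) (by rw [pOf_apply_5, eq4]; omega)]; ring

/-- **`Q(a) = 0` as soon as `d(b(a)) < 0`** (no convergence hypothesis): a non-zero term of (17) has `k₁ ≤ p₂ + q₂`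
(factor `C(q₂, k₁−p₂)`), `k₂ ≤ p₄ + q₄` (the range) and `k₁ + k₂ ≥ p₃` (the middle factor), while
`p₂ + q₂ + p₄ + q₄ − p₃ = d(b(a))`. -/
theorem QOf_eq_zero_of_dOf_neg (a : Fin 8 → ℤ) (hd : dOf (bOfA a) < 0) : QOf a = 0 := by
  have e3 : pOf a 3 = a 1 + a 2 + a 5 - a 7 := rfl
  have eq2 : qOf a 2 = a 0 + a 4 - a 2 := rfl
  rw [dOf_bOfA] at hd
  unfold QOf Qcoeff
  refine mul_eq_zero_of_right _ (sum_eq_zero fun k₁ hk₁ => sum_eq_zero fun k₂ hk₂ => ?_)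
  rw [mem_Icc, pOf_apply_1, qOf_apply_0] at hk₁
  rw [mem_Icc, pOf_apply_4, qOf_apply_3] at hk₂
  by_cases hk : qOf a 1 < k₁ - pOf a 2
  · rw [zchoose_eq_zero (n := qOf a 1) (k := k₁ - pOf a 2) (Or.inr hk)]; ring
  · rw [pOf_apply_2, qOf_apply_1] at hk
    rw [zchoose_eq_zero (n := k₁ + k₂ + qOf a 2 - pOf a 0 - pOf a 6) (k := pOf a 3 + qOf a 2 - pOf a 0 - pOf a 6)
      (by rw [pOf_apply_0, pOf_apply_6, e3, eq2]; omega)]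
    ring

/-- **Off the wide region `Q(a) = 0`**: unless every dual slot `b_i(a)` (`i ∈ [1,7]`) and `d(b(a))` are non-negative,
Brown–Zudilin's leading coefficient (17) vanishes. -/
theorem QOf_eq_zero_off_wide (a : Fin 8 → ℤ) (h : ¬ ((∀ i ∈ Icc 1 7, 0 ≤ bOfA a i) ∧ 0 ≤ dOf (bOfA a))) :
    QOf a = 0 := by
  by_cases hd : 0 ≤ dOf (bOfA a)
  · have h' : ¬ ∀ i ∈ Icc 1 7, 0 ≤ bOfA a i := fun hall => h ⟨hall, hd⟩
    push Not at h'
    obtain ⟨i, hi, hneg⟩ := h'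
    exact QOf_eq_zero_of_slot_neg a hi hneg
  · exact QOf_eq_zero_of_dOf_neg a (lt_of_not_ge hd)

/-- Contrapositive: `Q(a) ≠ 0` forces `b(a) ≥ 0` and `d(b(a)) ≥ 0`. -/
theorem wide_of_QOf_ne_zero (a : Fin 8 → ℤ) (h : QOf a ≠ 0) :
    (∀ i ∈ Icc 1 7, 0 ≤ bOfA a i) ∧ 0 ≤ dOf (bOfA a) := by
  by_contra hw
  exact h (QOf_eq_zero_off_wide a hw)

end Summit.KontsevichZagierPeriods.Zeta5Search.WedgeDictionary
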